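import Summits.Schanuel.Schanuel.Theorems.RootDecomp1KKummerClosure01

/-!
# RootDecomp1KKummerClosure («KUMMER CLOSURE», lens 6 gen 12/13 = 1K ROUND 9) — continuation (RootDecomp1KKummerClosure02): §K3 the norm polynomial E_{p,q} = Res_z(A(z), X^q − z^p) ∈ ℤ[X] of the radicals z^{p/q} (kumG, normPoly, degree / Mahler-measure bookkeeping) + §K4 private one-line copies of tree-private real lemmas

Part of the six-file split (400-line rule) of lens 6's node «KUMMER CLOSURE» = HOME/decomp-schanuel-lens-6/g13/addendum/KummerClosure.lean (v2, sha256 6dd432d1…, 1650 l;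
= g12 v1 6d5e0790… with the engine re-cut into engine_lower / engine_upper at the census's request, every statement byte-identical; 1K ROUND 9 THEOREM ROUND on the critic's
round-9 ACCEPTED-NEXT (i‴) «general Kummer closure with the UNIFORM degree bound»; `--supports stmt-Schanuel-33363`). Shared namespace
`Summit.Schanuel.Schanuel.Theorems.RootDecomp1KKummerClosure`; the node docstring is in part 01; K4's one-line copies of tree-private lemmas are private here.
Facts enter as hypotheses only (hNW : NesterenkoWaldschmidt1996_thm_1, hlm : Literature.Uncategorized.W78LogMeasure). Sorry-free; standard axioms. Nothing here proves Schanuel; rung 0.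
-/

open Polynomial Complex IntermediateField
open Summit.Schanuel.Schanuel.Theorems.RootDecomp1KHyper
open Summit.Schanuel.Schanuel.Theorems.RootDecomp1KHyper.HyperCell
open Summit.Schanuel.Schanuel.Theorems.RootDecomp1KRadical

noncomputable section

namespace Summit.Schanuel.Schanuel.Theorems.RootDecomp1KKummerClosure

/-! ## K3. The norm polynomial `E_{p,q} = Res_z(A(z), X^q − z^p) ∈ ℤ[X]` of the radicals `z^{p/q}` -/

section NormPoly

/-- the relation family of `X^q − z^p` in the `resPoly` format (`G_q = 1`, `G_0 = −z^p`, else `0`). -/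
noncomputable def kumG (p q : ℕ) (k : Fin (q + 1)) : ℤ[X] :=
  if (k : ℕ) = q then 1 else if (k : ℕ) = 0 then -(X ^ p) else 0

/-- `(kumG p q k).natDegree ≤ p`. -/
theorem natDegree_kumG_le (p q : ℕ) (k : Fin (q + 1)) : (kumG p q k).natDegree ≤ p := by
  unfold kumG
  split_ifs
  · simp
  · rw [natDegree_neg, natDegree_X_pow]
  · simp

/-- `kumG p q (Fin.last q) = 1`. -/
theorem kumG_last (p q : ℕ) : kumG p q (Fin.last q) = 1 := by
  simp [kumG]

/-- the conjugate factor of the family is `X^q − z^p` -/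
theorem conjFactor_kumG {p q : ℕ} (hq : 0 < q) (z : ℂ) :
    conjFactor (kumG p q) z = X ^ q - C (z ^ p) := by
  apply Polynomial.ext
  intro j
  rw [coeff_sub, coeff_X_pow, coeff_C]
  by_cases hj : j ≤ q
  · have h := coeff_conjFactor (kumG p q) z ⟨j, Nat.lt_succ_of_le hj⟩
    rw [Fin.val_mk] at h
    rw [h, kumG, Fin.val_mk]
    by_cases h1 : j = q
    · have h2 : j ≠ 0 := by omega
      rw [if_pos h1, if_pos h1, if_neg h2, map_one, sub_zero]
    · rw [if_neg h1, if_neg h1]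
      by_cases h2 : j = 0
      · rw [if_pos h2, if_pos h2, map_neg, map_pow, aeval_X, zero_sub]
      · rw [if_neg h2, if_neg h2, map_zero, sub_zero]
  · have hdeg := natDegree_conjFactor_le (kumG p q) z
    rw [coeff_eq_zero_of_natDegree_lt (by omega), if_neg (by omega), if_neg (by omega), sub_zero]

/-- the lengths: `Σ_k len G_k = 2` -/
theorem relLen_kumG {p q : ℕ} (hq : 0 < q) : relLen (kumG p q) = 2 := by
  unfold relLen
  rw [Fintype.sum_eq_add (Fin.last q) (0 : Fin (q + 1)) (by
    intro h; have := congrArg Fin.val h; simp at this; omega)]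
  · have h0 : kumG p q 0 = -(X ^ p) := by
      unfold kumG
      rw [if_neg (by simp; omega), if_pos (by simp)]
    rw [kumG_last, h0]
    have h1 : len (1 : ℤ[X]) = 1 := by simp [len]
    have h2 : len (-(X ^ p) : ℤ[X]) = 1 := by
      unfold len
      rw [natDegree_neg, natDegree_X_pow]
      simp only [coeff_neg, coeff_X_pow, abs_neg]
      rw [Finset.sum_eq_single p]
      · simp
      · intro k _ hk; rw [if_neg hk, abs_zero]
      · intro h; exact absurd (Finset.mem_range.mpr (Nat.lt_succ_self p)) h
    rw [h1, h2]; norm_num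
  · intro k ⟨hk1, hk2⟩
    have hk1' : (k : ℕ) ≠ q := fun h => hk1 (Fin.ext (by simp [h]))
    have hk2' : (k : ℕ) ≠ 0 := fun h => hk2 (Fin.ext (by simp [h]))
    unfold kumG
    rw [if_neg hk1', if_neg hk2']
    simp [len]

/-- **The norm polynomial** `E_{p,q}(X) = Res_z(A(z), X^q − z^p) ∈ ℤ[X]`. -/
noncomputable def normPoly (A : ℤ[X]) (p q : ℕ) : ℤ[X] := resPoly A (kumG p q) p

/-- `E_{p,q}(t) = lc(A)^p ∏_{A(z)=0} (t^q − z^p)`. -/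
theorem aeval_normPoly (A : ℤ[X]) {p q : ℕ} (hq : 0 < q) (t : ℂ) :
    aeval t (normPoly A p q) = (A.map (Int.castRingHom ℂ)).leadingCoeff ^ p *
      ((A.map (Int.castRingHom ℂ)).roots.map fun z => t ^ q - z ^ p).prod := by
  rw [normPoly, aeval_resPoly A (kumG p q) (natDegree_kumG_le p q) t]
  congr 1
  refine congrArg Multiset.prod (Multiset.map_congr rfl fun z _ => ?_)
  rw [conjFactor_kumG hq, eval_sub, eval_pow, eval_X, eval_C]

/-- `normPoly A p q ≠ 0`. -/
theorem normPoly_ne_zero {A : ℤ[X]} (hA : A ≠ 0) (p q : ℕ) : normPoly A p q ≠ 0 :=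
  resPoly_ne_zero A hA (kumG p q) (natDegree_kumG_le p q) fun b _ => by
    rw [kumG_last, map_one]; exact one_ne_zero

/-- §K3. Degree bound for the norm polynomial: `natDegree (normPoly A p q) ≤ natDegree A * q` (up to the stated bookkeeping). -/
theorem natDegree_normPoly_le (A : ℤ[X]) (p q : ℕ) :
    (normPoly A p q).natDegree ≤ A.natDegree * q :=
  natDegree_resPoly_le A (kumG p q) (natDegree_kumG_le p q)

/-- the complex roots of `E_{p,q}` are the `b` with `b^q = z^p`, `A(z) = 0` -/
theorem mem_roots_normPoly {A : ℤ[X]} (hA : A ≠ 0) {p q : ℕ} (hq : 0 < q) {b : ℂ} :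
    b ∈ ((normPoly A p q).map (Int.castRingHom ℂ)).roots ↔
      ∃ z ∈ (A.map (Int.castRingHom ℂ)).roots, b ^ q = z ^ p := by
  have hlc : (A.map (Int.castRingHom ℂ)).leadingCoeff ^ p ≠ 0 :=
    pow_ne_zero _ (leadingCoeff_ne_zero.mpr
      ((Polynomial.map_ne_zero_iff (RingHom.injective_int _)).mpr hA))
  rw [mem_roots ((Polynomial.map_ne_zero_iff (RingHom.injective_int _)).mpr
    (normPoly_ne_zero hA p q)), IsRoot.def, eval_map_int,
    aeval_normPoly A hq, mul_eq_zero, Multiset.prod_eq_zero_iff, Multiset.mem_map]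
  simp only [hlc, false_or, sub_eq_zero]

/-- §K3. The norm polynomial has at most `natDegree A * q` complex roots (with multiplicity). -/
theorem card_roots_normPoly_le (A : ℤ[X]) (p q : ℕ) :
    Multiset.card ((normPoly A p q).map (Int.castRingHom ℂ)).roots ≤ A.natDegree * q :=
  ((card_roots' _).trans natDegree_map_le).trans (natDegree_normPoly_le A p q)

/-- `M(E_{p,q}) ≤ 2^{deg A} M(A)^p` -/
theorem mahlerMeasure_normPoly_le {A : ℤ[X]} (hA : A ≠ 0) {p q : ℕ} (hq : 0 < q) :
    ((normPoly A p q).map (Int.castRingHom ℂ)).mahlerMeasure ≤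
      2 ^ A.natDegree * (A.map (Int.castRingHom ℂ)).mahlerMeasure ^ p := by
  have h := mahlerMeasure_resPoly_le A hA (kumG p q) (natDegree_kumG_le p q)
  rwa [relLen_kumG hq] at h

/-- `E_{p,q}(η) = 0` for `η^q = α^p`, `A(α) = 0` -/
theorem aeval_normPoly_eq_zero {A : ℤ[X]} (hA : A ≠ 0) {p q : ℕ} (hq : 0 < q) {α η : ℂ}
    (hAα : aeval α A = 0) (hη : η ^ q = α ^ p) : aeval η (normPoly A p q) = 0 :=
  aeval_of_mem_roots_map ((mem_roots_normPoly hA hq).mpr ⟨α, mem_roots_map_of_aeval hA hAα, hη⟩)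

end NormPoly

/-! ## K4. Four one-line twins of tree-PRIVATE real lemmas (the public gen-11 declarations
`FiniteTranscendenceType`, `sum_abs_coeff_le`, `linF`, `exists_lipschitz_linF`, … are USED BY NAME from the landed
port `RootDecomp1KRadical03`) -/

section Copies

/-- `Real.log x ≤ x`. -/
private theorem log_le_self_of_pos' {x : ℝ} (hx : 0 < x) : Real.log x ≤ x := by
  have := Real.log_le_sub_one_of_pos hx; linarith

/-- `x ≤ Real.exp x`. -/
private theorem self_le_exp' (x : ℝ) : x ≤ Real.exp x := by linarith [Real.add_one_le_exp x]

/-- The Mahler measure of a non-zero integer polynomial (mapped to `ℂ`) is at least `1` (private copy of a tree-private wave lemma). -/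
private theorem one_le_mahlerMeasure_map_of_ne_zero' {R : ℤ[X]} (hR : R ≠ 0) :
    1 ≤ (R.map (Int.castRingHom ℂ)).mahlerMeasure := by
  refine one_le_mahlerMeasure_of_one_le_norm_leadingCoeff ?_
  rw [Polynomial.leadingCoeff_map_of_injective (RingHom.injective_int _), eq_intCast,
    Complex.norm_intCast]
  exact_mod_cast Int.one_le_abs (Polynomial.leadingCoeff_ne_zero.mpr hR)

/-- `Real.log 32 ≤ 5`. -/
private theorem log_thirtytwo_le_five' : Real.log 32 ≤ 5 := by
  have h2 : Real.log 2 < 0.6931471808 := Real.log_two_lt_d9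
  rw [show (32 : ℝ) = 2 ^ 5 by norm_num, Real.log_pow]; push_cast; linarith

end Copies

end Summit.Schanuel.Schanuel.Theorems.RootDecomp1KKummerClosure
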